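/-
COR-CM (cell pub-hodgecm2, stage 2 of the Hodge ladder) — count-neutral KERNEL COMBINATORICS «dicyclic twist: the number of blocks by Burnside»
(seat prover-pub-hodgecm2-b23-g42-0, binder prover b23, gen 42; claim DICYCLIC-COLUMN, HOME/INBOX.md l.10328).
Theorems only (one bookkeeping `def ιHom` with body), on top of `Census/DicyclicTwistPlaces.lean` and seat b09's Burnside count
`Census/BlockParityBurnside.lean` used BY NAME; no `decide` table, no certificate, no named fact, no `sorry`; `Interfaces.lean` (C1), every E term, B01,
`Transposition/*`, `PortJoin/*` untouched.
HONEST FRAMING: `HC_CM` is NOT proved, here or anywhere in the tree; nothing here is a period, a count of record or a headline.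
T5: n/a-class (hypothesis binders: the dicyclic datum, `c * c = 1`, `|A|` odd); checker: self, 2026-08-23.
-/
import Summits.HodgeConjecture.CorCM.Census.DicyclicTwistPlaces
import Summits.HodgeConjecture.CorCM.Census.BlockParityBurnside

/-!
# The dicyclic twist: `β(G, c) · 4|A| = Σ_{s ∈ A} 4^{|A| / ord s}`

Along a dicyclic datum `D` on `(G, c)` over a finite abelian group `A` of ODD order (`Census/DicyclicTwistDictionary.lean`), seat b09's Burnside count
(`Census/BlockParityBurnside.lean` `card_block_mul_card`: `β · |G| = Σ_g [c ∉ ⟨g⟩] 2^{|G|/ord g/2}`) evaluates in closed form: the elements `x·ι a` have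
square `c` (no contribution), `c ∈ ⟨ι(e, s)⟩ ↔ e = 1` (`|A|` odd), and `ord ι(0, s) = ord s`, whence

  **`β(G, c) · 4|A| = Σ_{s ∈ A} 4^{|A| / ord s}`** (`card_block_mul_four_card`),

e.g. for `A = ℤ/p`, `p` an odd prime: `β = (4^{p−1} + p − 1)/p` (`6, 52, 586` for `p = 3, 5, 7`).  With the dicyclic law
(`Census/DicyclicTwistTransport.lean` `isLeast_card_gfaces_generate`: `μ = β − 1`) this is the dicyclic column of the census in closed form.  All [folklore].

## References
* [Milne1999] J. S. Milne, Lefschetz motives and the Tate conjecture, Compositio Math. 117 (1999), Prop. 2.1, p. 54.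
-/

namespace Summit.HodgeConjecture.CorCM.Census.DicyclicTwist

open Finset
open Summit.HodgeConjecture.CorCM.Prior.AllgGroup.RfwfAllgGroup
open Summit.HodgeConjecture.CorCM.Census.BlockParity

noncomputable section

variable {G : Type*} [Group G] [Fintype G] [DecidableEq G] {c : G}
variable {A : Type} [AddCommGroup A] [Fintype A] [DecidableEq A]
variable (D : Datum G c A)

/-! ## §1 Orders and cyclic subgroups along the datum -/

/-- The embedding `ι` as a monoid homomorphism from `Multiplicative (ℤ/2 × A)`. [folklore] -/
def ιHom : Multiplicative (ZMod 2 × A) →* G where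
  toFun a := D.ι a.toAdd
  map_one' := ι_zero D
  map_mul' _ _ := D.map_add _ _

omit [Fintype G] [DecidableEq G] [Fintype A] [DecidableEq A] in
/-- `ιHom (ofAdd a) = ι a`. [folklore] -/
@[simp] theorem ιHom_apply (a : ZMod 2 × A) : ιHom D (Multiplicative.ofAdd a) = D.ι a := rfl

omit [Fintype G] [DecidableEq G] [Fintype A] [DecidableEq A] in
/-- `ιHom` is injective. [folklore] -/
theorem ιHom_injective : Function.Injective (ιHom D) := fun _ _ h => Multiplicative.toAdd.injective (D.inj h)

omit [Fintype G] [DecidableEq G] [Fintype A] [DecidableEq A] in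
/-- **Powers along `ι`**: `(ι a)^n = ι (n • a)`. [folklore] -/
theorem ι_pow (a : ZMod 2 × A) (n : ℕ) : D.ι a ^ n = D.ι (n • a) := by
  show ιHom D (Multiplicative.ofAdd a) ^ n = ιHom D (Multiplicative.ofAdd (n • a))
  rw [ofAdd_nsmul, map_pow]

omit [Fintype G] [DecidableEq G] [Fintype A] [DecidableEq A] in
/-- Integer powers along `ι`: `(ι a)^k = ι (k • a)`. [folklore] -/
theorem ι_zpow (a : ZMod 2 × A) (k : ℤ) : D.ι a ^ k = D.ι (k • a) := by
  show ιHom D (Multiplicative.ofAdd a) ^ k = ιHom D (Multiplicative.ofAdd (k • a))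
  rw [ofAdd_zsmul, map_zpow]

omit [Fintype G] [DecidableEq G] [Fintype A] [DecidableEq A] in
/-- **`ι` preserves orders**: `ord ι a = ord a`. [folklore] -/
theorem orderOf_ι (a : ZMod 2 × A) : orderOf (D.ι a) = addOrderOf a := by
  rw [← ιHom_apply, orderOf_injective (ιHom D) (ιHom_injective D), orderOf_ofAdd_eq_addOrderOf]

omit [DecidableEq A] [Fintype A] in
/-- The order of `(0, s)` is the order of `s`. [folklore] -/
theorem addOrderOf_zero_mk (s : A) : addOrderOf ((0 : ZMod 2), s) = addOrderOf s := by
  rw [Prod.addOrderOf, addOrderOf_zero, Nat.lcm_one_left]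

omit [Fintype G] [DecidableEq G] [Fintype A] [DecidableEq A] in
/-- **`(x·ι a)² = c`.** [folklore] -/
theorem xι_sq (a : ZMod 2 × A) : (D.x * D.ι a) ^ 2 = c := by
  rw [pow_two, xι_mul_xι, sub_self, add_zero, D.map_c]

omit [Fintype G] [DecidableEq G] [Fintype A] [DecidableEq A] in
/-- `c ∈ ⟨x·ι a⟩`. [folklore] -/
theorem c_mem_zpowers_xι (a : ZMod 2 × A) : c ∈ Subgroup.zpowers (D.x * D.ι a) :=
  Subgroup.mem_zpowers_iff.mpr ⟨2, by rw [zpow_two, ← pow_two]; exact xι_sq D a⟩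

omit [Fintype G] [DecidableEq G] [DecidableEq A] in
/-- **`c ∈ ⟨ι(e, s)⟩ ↔ e = 1`** (`|A|` odd). [folklore] -/
theorem c_mem_zpowers_ι_iff (hA : Odd (Fintype.card A)) (e : ZMod 2) (s : A) : c ∈ Subgroup.zpowers (D.ι (e, s)) ↔ e = 1 := by
  constructor
  · intro h
    obtain ⟨k, hk⟩ := Subgroup.mem_zpowers_iff.mp h
    rw [ι_zpow] at hk
    have h1 : (k • ((e, s) : ZMod 2 × A)).1 = (((1 : ZMod 2), (0 : A)) : ZMod 2 × A).1 :=
      congrArg Prod.fst (D.inj (hk.trans D.map_c.symm))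
    simp only [Prod.smul_fst] at h1
    have key : ∀ u : ZMod 2, u ≠ 0 → u = 1 := by decide
    refine key e fun he => ?_
    rw [he, smul_zero] at h1
    exact zero_ne_one h1
  · rintro rfl
    have hodd : Odd (addOrderOf s) := hA.of_dvd_nat (addOrderOf_dvd_card (x := s))
    refine Subgroup.mem_zpowers_iff.mpr ⟨(addOrderOf s : ℤ), ?_⟩
    have hn : addOrderOf s • ((1 : ZMod 2), s) = (1, 0) := by
      rw [Prod.smul_mk, addOrderOf_nsmul_eq_zero, nsmul_eq_mul, mul_one, ← ZMod.natCast_mod, Nat.odd_iff.mp hodd, Nat.cast_one]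
    rw [zpow_natCast, ι_pow, hn]
    exact D.map_c

/-! ## §2 The count -/

omit [DecidableEq A] in
include D in
/-- **`β(G, c) · 4|A| = Σ_{s ∈ A} 4^{|A| / ord s}`** (`|A|` odd; seat b09's Burnside count evaluated along the datum). [folklore] -/
theorem card_block_mul_four_card (hc2 : c * c = 1) (hA : Odd (Fintype.card A)) :
    Fintype.card (BlockParity.Block c) * (4 * Fintype.card A) = ∑ s : A, 4 ^ (Fintype.card A / addOrderOf s) := by
  classical
  rw [← card_eq_four_mul D, card_block_mul_card c hc2 (mul_c_comm D)]
  -- reindex the sum over `G` along `(ℤ/2 × A) ⊕ (ℤ/2 × A) ≃ G`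
  have hb : Function.Bijective (Sum.elim D.ι fun a => D.x * D.ι a : (ZMod 2 × A) ⊕ (ZMod 2 × A) → G) := by
    constructor
    · rintro (a | a) (b | b) h
      · exact congrArg Sum.inl (D.inj h)
      · exact absurd (h : D.ι a = D.x * D.ι b) (ι_ne_xι D a b)
      · exact absurd (h : D.x * D.ι a = D.ι b).symm (ι_ne_xι D b a)
      · exact congrArg Sum.inr (xι_injective D (h : D.x * D.ι a = D.x * D.ι b))
    · intro g
      obtain ⟨a, rfl | rfl⟩ := D.exhaust g
      · exact ⟨Sum.inl a, rfl⟩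
      · exact ⟨Sum.inr a, rfl⟩
  rw [← Equiv.sum_comp (Equiv.ofBijective _ hb), Fintype.sum_sum_type]
  simp only [Equiv.ofBijective_apply, Sum.elim_inl, Sum.elim_inr, c_mem_zpowers_xι D, if_true, Finset.sum_const_zero, add_zero]
  -- the `ι`-half: sum over `ℤ/2 × A` as a sum over `s` of the two terms `e = 0, 1`
  rw [Fintype.sum_prod_type_right]
  refine Finset.sum_congr rfl fun s _ => ?_
  have huniv : (Finset.univ : Finset (ZMod 2)) = {0, 1} := by decide
  rw [huniv, Finset.sum_pair (show (0 : ZMod 2) ≠ 1 by decide),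
    if_neg (fun h => zero_ne_one ((c_mem_zpowers_ι_iff D hA 0 s).mp h)), if_pos ((c_mem_zpowers_ι_iff D hA 1 s).mpr rfl), add_zero,
    orderOf_ι, addOrderOf_zero_mk, card_eq_four_mul D]
  obtain ⟨d, hd⟩ := addOrderOf_dvd_card (x := s)
  have hpos : 0 < addOrderOf s := addOrderOf_pos s
  have hdiv : Fintype.card A / addOrderOf s = d := by rw [hd, Nat.mul_div_cancel_left d hpos]
  have hdiv' : 4 * Fintype.card A / addOrderOf s / 2 = 2 * d := by
    rw [hd, show 4 * (addOrderOf s * d) = addOrderOf s * (4 * d) by ring, Nat.mul_div_cancel_left _ hpos]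
    omega
  rw [hdiv, hdiv', pow_mul]
  norm_num

omit [DecidableEq A] in
include D in
/-- **Prime order**: for `|A| = p` prime (odd), `β(G, c) · 4p = 4^p + 4(p − 1)`, i.e. `β = (4^{p−1} + p − 1)/p`. [folklore] -/
theorem card_block_mul_of_prime (hc2 : c * c = 1) (hp : (Fintype.card A).Prime) (hp2 : Fintype.card A ≠ 2) :
    Fintype.card (BlockParity.Block c) * (4 * Fintype.card A) = 4 ^ Fintype.card A + 4 * (Fintype.card A - 1) := by
  classical
  have hA : Odd (Fintype.card A) := hp.odd_of_ne_two hp2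
  rw [card_block_mul_four_card D hc2 hA, ← Finset.add_sum_erase _ _ (Finset.mem_univ (0 : A)), addOrderOf_zero, Nat.div_one]
  congr 1
  have hterm : ∀ s ∈ (Finset.univ : Finset A).erase 0, 4 ^ (Fintype.card A / addOrderOf s) = 4 := by
    intro s hs
    have hs0 : s ≠ 0 := Finset.ne_of_mem_erase hs
    have hord : addOrderOf s = Fintype.card A := by
      rcases hp.eq_one_or_self_of_dvd _ (addOrderOf_dvd_card (x := s)) with h | h
      · exact absurd (AddMonoid.addOrderOf_eq_one_iff.mp h) hs0
      · exact h
    rw [hord, Nat.div_self hp.pos, pow_one]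
  rw [Finset.sum_congr rfl hterm, Finset.sum_const, smul_eq_mul, Finset.card_erase_of_mem (Finset.mem_univ _), Finset.card_univ, mul_comm]

omit [DecidableEq A] in
include D in
/-- **`β(Dic₃) = 6`** (`|A| = 3`, degree `12`): with the law, `μ = 5` (lit-andre-3's atlas row `Census/DodecicDicyclicLattice.lean`). [folklore] -/
theorem card_block_eq_six (hc2 : c * c = 1) (h3 : Fintype.card A = 3) : Fintype.card (BlockParity.Block c) = 6 := by
  have h := card_block_mul_of_prime D hc2 (by rw [h3]; norm_num) (by rw [h3]; norm_num)
  rw [h3] at h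
  omega

omit [DecidableEq A] in
include D in
/-- **`β(Dic₅) = 52`** (`|A| = 5`, degree `20`): with the law, `μ = 51` (atlas row `Census/IcosicDicyclicLattice.lean`). [folklore] -/
theorem card_block_eq_fiftyTwo (hc2 : c * c = 1) (h5 : Fintype.card A = 5) : Fintype.card (BlockParity.Block c) = 52 := by
  have h := card_block_mul_of_prime D hc2 (by rw [h5]; norm_num) (by rw [h5]; norm_num)
  rw [h5] at h
  omega

omit [DecidableEq A] in
include D in
/-- **`β(Dic₇) = 586`** (`|A| = 7`, degree `28`): with the law, `μ = 585` — a row beyond the certified atlas. [folklore] -/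
theorem card_block_eq_fiveHundredEightySix (hc2 : c * c = 1) (h7 : Fintype.card A = 7) : Fintype.card (BlockParity.Block c) = 586 := by
  have h := card_block_mul_of_prime D hc2 (by rw [h7]; norm_num) (by rw [h7]; norm_num)
  rw [h7] at h
  omega

end

end Summit.HodgeConjecture.CorCM.Census.DicyclicTwist
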